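import Summits.CriticalPhenomena.CardyFormulaZ2.Theorems.CardySelfRefinementLagHandOffHalfPlaneThreeArmUndockedPolarQuad
import Summits.CriticalPhenomena.CardyFormulaZ2.Theorems.CardySelfRefinementLagHandOffHalfPlaneThreeArmUndockedFaceChain
import Summits.CriticalPhenomena.CardyFormulaZ2.Theorems.CardySelfRefinementLagHandOffHalfPlaneThreeArmUndockedLattice
import Summits.CriticalPhenomena.CardyFormulaZ2.Theorems.CardySelfRefinementLagHandOffHalfPlaneThreeArmUndockedSymmetry
import HarnessLib

/-!
# The third arm by planar duality (extraction step of the cluster-form half-plane three-arm bound)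

Support file for the registered stub `stub_noTouch_undockedThreeArm` of crux
stmt-CriticalPhenomena-10268 (line `hitting-tournament`):

* `stub_undockedThreeArm_extraction` — on a lattice configuration, two open paths of the
  half-annulus of sites `S` from the disc `dist ≤ a` to `dist ≥ b` around a lattice point `c`
  (rows `≥` that of `c`), NOT joined inside `S`, put `ω` in the disjoint occurrence `U₂ □ O₁` of
  the undocked two-arm event `U₂` (radii `a - 2δ`, `b + 2δ`, centre `c`: an open path and a
  dual path of faces of rows `≥ c₁` crossing closed edges) and the open annulus crossing
  `O₁ = annulusOpenCrossing c δ a b`.  With `𝒞` the sites joined to the first path inside `S`,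
  `A` the open edges inside `𝒞` and `B` the open edges of `S` off `𝒞`, no edge of `A` meets an
  edge of `B`, the first path is drawn inside `A` and the second inside `B`, so the polar
  half-annulus quad (`stub_undockedThreeArm_polarQuad`) has no crossing between its boundary
  segments inside the drawn edges of `A ∪ B` (`stub_undockedThreeArm_noCrossing`); continuum
  duality (`Quad.exists_path_avoiding_of_not_exists_isCrossing`) gives a path from the inner to
  the outer semicircle off those edges, shadowed by a dual chain of faces of rows `≥ c₁`
  (`stub_undockedThreeArm_upperFaceChain`) each of whose steps crosses an edge of `S` outside
  `A ∪ B`, hence closed; the witnesses (first path + closed edges; second path) are disjoint.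

References: G. Grimmett, *Percolation* (1999), §11.2 [GrimmettPercolation1999]; O. Schramm,
S. Smirnov, Ann. Probab. 39 (2011), §1.3 and proof of Lemma 6.1 [SchrammSmirnov2011];
D. Reimer, Combin. Probab. Comput. 9 (2000) (disjoint occurrence) [ReimerCPC2000].
-/

noncomputable section

open Set Metric Complex MeasureTheory SimpleGraph
open scoped unitInterval
open Literature.Probability.Percolation Literature.Probability.LatticeModels
open Literature.Probability.Percolation.QuadCrossing

namespace Summit.CriticalPhenomena.CardyFormulaZ2.Cruxes.LagHandOff.HittingTournament

/-! ### The third arm by planar duality -/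

/-- Monotonicity of the drawn edges in the configuration. [folklore] -/
theorem openEdgeUnion_mono {δ : ℝ} {A B : BondConfig (Site 2)} (h : A ⊆ B) :
    openEdgeUnion δ A ⊆ openEdgeUnion δ B := fun z hz => by
  obtain ⟨x, y, hxy, hA, hz⟩ := mem_openEdgeUnion_iff.1 hz
  exact mem_openEdgeUnion_iff.2 ⟨x, y, hxy, h hA, hz⟩

/-- **Two unjoined open paths of a half-annulus give the undocked two-arm event and a disjoint
open crossing.**  Let `δ > 0`, `ω` a lattice configuration, `c = δ c₀` a lattice point, radii
`4δ ≤ r'`, `r' + 4δ < R'`, and `S` a set of sites of rows `≥ c₀ 1` containing every such site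
at distance in `[r' - 4δ, R' + 4δ]` from `c`.  If `ω` has open paths of `S` from `v₁`, `v₂`
(within `r' + 2δ` of `c`) to `w₁`, `w₂` (at distance `≥ R' - 2δ`) and `v₁`, `v₂` are not joined
by an open path of `S`, then `ω` lies in `U₂ □ O₁`, `U₂` the undocked two-arm event of the
half-annulus `{r' ≤ dist (δ v, c) ≤ R', Im c ≤ Im (δ v)}` (an open path and a dual-open path from
the `2r'`-disc to beyond `R'/2`) and `O₁` the open crossing of the annulus `A(c; r' + 2δ, R' - 2δ)`
(see the module docstring for the proof). [cite: LawlerSchrammWernerEJP2002, Appendix A] -/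
theorem stub_undockedThreeArm_extraction : ∀ {δ : ℝ}, 0 < δ → ∀ {ω : BondConfig (Site 2)},
    ω ⊆ (zdGraph 2).edgeSet → ∀ (c₀ : Site 2) {r' R' : ℝ}, 4 * δ ≤ r' → r' + 4 * δ < R' →
    ∀ (S : Set (Site 2)), (∀ v ∈ S, c₀ 1 ≤ v 1) →
    (∀ v : Site 2, c₀ 1 ≤ v 1 → r' - 4 * δ ≤ dist (meshPoint δ v) (meshPoint δ c₀) →
      dist (meshPoint δ v) (meshPoint δ c₀) ≤ R' + 4 * δ → v ∈ S) →
    ∀ {v₁ w₁ v₂ w₂ : Site 2}, dist (meshPoint δ v₁) (meshPoint δ c₀) ≤ r' + 2 * δ →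
    dist (meshPoint δ v₂) (meshPoint δ c₀) ≤ r' + 2 * δ →
    R' - 2 * δ ≤ dist (meshPoint δ w₁) (meshPoint δ c₀) → R' - 2 * δ ≤ dist (meshPoint δ w₂) (meshPoint δ c₀) →
    ω ∈ openConnIn S v₁ w₁ → ω ∈ openConnIn S v₂ w₂ → ω ∉ openConnIn S v₁ v₂ →
    ω ∈ {ω : BondConfig (Site 2) | ∃ v w f g : Site 2,
        dist (meshPoint δ v) (meshPoint δ c₀) ≤ 2 * r' ∧ dist (meshPoint δ f) (meshPoint δ c₀) ≤ 2 * r' ∧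
        R' / 2 ≤ dist (meshPoint δ w) (meshPoint δ c₀) ∧ R' / 2 ≤ dist (meshPoint δ g) (meshPoint δ c₀) ∧
        ω ∈ openConnIn {v : Site 2 | r' ≤ dist (meshPoint δ v) (meshPoint δ c₀) ∧
          dist (meshPoint δ v) (meshPoint δ c₀) ≤ R' ∧ (meshPoint δ c₀).im ≤ (meshPoint δ v).im} v w ∧
        dualConfig ω ∈ openConnIn {v : Site 2 | r' ≤ dist (meshPoint δ v) (meshPoint δ c₀) ∧
          dist (meshPoint δ v) (meshPoint δ c₀) ≤ R' ∧ (meshPoint δ c₀).im ≤ (meshPoint δ v).im} f g} □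
      annulusOpenCrossing (meshPoint δ c₀) δ (r' + 2 * δ) (R' - 2 * δ) := by
  intro δ hδ ω hω c₀ r' R' hr' hR' S hSrow hSbig v₁ w₁ v₂ w₂ hv₁ hv₂ hw₁ hw₂ h₁ h₂ h₁₂
  classical
  set c := meshPoint δ c₀ with hc
  set k₀ : ℤ := c₀ 1 with hk₀
  set a : ℝ := r' + 2 * δ with ha
  set b : ℝ := R' - 2 * δ with hb
  have hab : a < b := by rw [ha, hb]; linarith
  have ha0 : 0 < a := by rw [ha]; linarith
  have habs : |δ| = δ := abs_of_pos hδ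
  have hcim : c.im = δ * k₀ := by rw [hc, meshPoint_im]
  set S' : Set (Site 2) := {v : Site 2 | r' ≤ dist (meshPoint δ v) c ∧ dist (meshPoint δ v) c ≤ R' ∧
    c.im ≤ (meshPoint δ v).im} with hS'
  have hrowS' : ∀ v : Site 2, c.im ≤ (meshPoint δ v).im ↔ k₀ ≤ v 1 := fun v => by
    rw [hcim, meshPoint_im]
    exact ⟨fun h => by exact_mod_cast le_of_mul_le_mul_left h hδ, fun h => mul_le_mul_of_nonneg_left (by exact_mod_cast h) hδ.le⟩
  -- the quad
  obtain ⟨Q, hcar, hs1, hs3⟩ := stub_undockedThreeArm_polarQuad c a b ha0 hab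
  -- the walks
  obtain ⟨W₁, hW₁S, hW₁ω⟩ := exists_walk_of_mem_openConnIn hω h₁
  obtain ⟨W₂, hW₂S, hW₂ω⟩ := exists_walk_of_mem_openConnIn hω h₂
  -- the cluster of `v₁` inside `S` and the two colour classes of open edges
  set 𝒞 : Set (Site 2) := {z | ω ∈ openConnIn S v₁ z} with h𝒞
  set A : BondConfig (Site 2) := {e | e ∈ ω ∧ ∀ z ∈ e, z ∈ 𝒞} with hA
  set B : BondConfig (Site 2) := {e | e ∈ ω ∧ ∀ z ∈ e, z ∈ S ∧ z ∉ 𝒞} with hB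
  have hAB : ∀ e ∈ A, ∀ e' ∈ B, ∀ v : Site 2, v ∈ e → v ∈ e' → False :=
    fun e he e' he' v hv hv' => (he'.2 v hv').2 (he.2 v hv)
  -- open edges of `S` are of one of the two colours
  have hcolour : ∀ e ∈ ω, (∀ z ∈ e, z ∈ S) → e ∈ A ∪ B := by
    intro e heω heS
    have heE : e ∈ (zdGraph 2).edgeSet := hω heω
    induction e using Sym2.ind with
    | h p q =>
      have hpq : (zdGraph 2).Adj p q := (mem_edgeSet (G := zdGraph 2)).1 heE
      have hpS := heS p (Sym2.mem_mk_left p q)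
      have hqS := heS q (Sym2.mem_mk_right p q)
      have hpq' : ω ∈ openConnIn S p q := openConnIn_of_adj hpS hqS heω hpq.ne
      by_cases hp : p ∈ 𝒞
      · have hq : q ∈ 𝒞 := PlanarDuality.openConnIn_trans hp hpq'
        refine Or.inl ⟨heω, fun z hz => ?_⟩
        rcases Sym2.mem_iff.1 hz with rfl | rfl
        exacts [hp, hq]
      · have hq : q ∉ 𝒞 := fun hq => hp (PlanarDuality.openConnIn_trans hq (by rw [openConnIn_comm]; exact hpq'))
        refine Or.inr ⟨heω, fun z hz => ?_⟩
        rcases Sym2.mem_iff.1 hz with rfl | rfl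
        exacts [⟨hpS, hp⟩, ⟨hqS, hq⟩]
  have hclosed : ∀ e ∈ (zdGraph 2).edgeSet, (∀ z ∈ e, z ∈ S) → e ∉ A ∪ B → e ∉ ω :=
    fun e _ heS hne heω => hne (hcolour e heω heS)
  -- the first walk is of colour `A`, the second of colour `B`
  have hW₁A : ∀ e ∈ W₁.edges, e ∈ A := fun e he =>
    ⟨hW₁ω e he, fun z hz => mem_openConnIn_of_mem_support W₁ hW₁S hW₁ω (W₁.mem_support_of_mem_edges he hz)⟩
  have hW₂𝒞 : ∀ z ∈ W₂.support, z ∉ 𝒞 := fun z hz hz𝒞 =>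
    h₁₂ (PlanarDuality.openConnIn_trans hz𝒞 (by
      rw [openConnIn_comm]; exact mem_openConnIn_of_mem_support W₂ hW₂S hW₂ω hz))
  have hW₂B : ∀ e ∈ W₂.edges, e ∈ B := fun e he =>
    ⟨hW₂ω e he, fun z hz => ⟨hW₂S z (W₂.mem_support_of_mem_edges he hz), hW₂𝒞 z (W₂.mem_support_of_mem_edges he hz)⟩⟩
  -- sub-walks crossing the annulus `a ≤ dist ≤ b`
  obtain ⟨x₁, y₁, W₁', hx₁, hy₁, hW₁'supp, hW₁'edges, hW₁'dist⟩ :=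
    stub_undockedThreeArm_subwalk (δ := δ) c hab W₁ (by rw [ha]; exact hv₁) (by rw [hb]; exact hw₁)
  obtain ⟨x₂, y₂, W₂', hx₂, hy₂, hW₂'supp, hW₂'edges, hW₂'dist⟩ :=
    stub_undockedThreeArm_subwalk (δ := δ) c hab W₂ (by rw [ha]; exact hv₂) (by rw [hb]; exact hw₂)
  have hW₁'row : ∀ z ∈ W₁'.support, c₀ 1 ≤ z 1 := fun z hz => hSrow z (hW₁S z (hW₁'supp z hz))
  have hW₂'row : ∀ z ∈ W₂'.support, c₀ 1 ≤ z 1 := fun z hz => hSrow z (hW₂S z (hW₂'supp z hz))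
  -- their clipped drawings, paths of `[Q]` from `∂₁Q` to `∂₃Q` inside `O_A`, `O_B`
  obtain ⟨β₁, hβ₁c, hβ₁m, hβ₁0, hβ₁1, hβ₁O⟩ := stub_undockedThreeArm_clip hδ c₀ hab W₁' hW₁'row hx₁ hy₁
  obtain ⟨β₂, hβ₂c, hβ₂m, hβ₂0, hβ₂1, hβ₂O⟩ := stub_undockedThreeArm_clip hδ c₀ hab W₂' hW₂'row hx₂ hy₂
  have hβ₁Q : MapsTo β₁ (Icc 0 1) Q.carrier := fun t ht => by rw [hcar]; exact hβ₁m t ht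
  have hβ₂Q : MapsTo β₂ (Icc 0 1) Q.carrier := fun t ht => by rw [hcar]; exact hβ₂m t ht
  have h0I : (0 : ℝ) ∈ Icc (0 : ℝ) 1 := ⟨le_rfl, zero_le_one⟩
  have h1I : (1 : ℝ) ∈ Icc (0 : ℝ) 1 := ⟨zero_le_one, le_rfl⟩
  have hβ₁s0 : β₁ 0 ∈ Q.side 1 := by rw [hs1]; exact ⟨hβ₁0, (hβ₁m 0 h0I).2.2⟩
  have hβ₁s1 : β₁ 1 ∈ Q.side 3 := by rw [hs3]; exact ⟨hβ₁1, (hβ₁m 1 h1I).2.2⟩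
  have hβ₂s0 : β₂ 0 ∈ Q.side 1 := by rw [hs1]; exact ⟨hβ₂0, (hβ₂m 0 h0I).2.2⟩
  have hβ₂s1 : β₂ 1 ∈ Q.side 3 := by rw [hs3]; exact ⟨hβ₂1, (hβ₂m 1 h1I).2.2⟩
  have hβ₁A : ∀ t ∈ Icc (0 : ℝ) 1, β₁ t ∈ openEdgeUnion δ A := fun t ht =>
    openEdgeUnion_mono (fun e he => hW₁A e (hW₁'edges e he)) (hβ₁O t ht)
  have hβ₂B : ∀ t ∈ Icc (0 : ℝ) 1, β₂ t ∈ openEdgeUnion δ B := fun t ht =>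
    openEdgeUnion_mono (fun e he => hW₂B e (hW₂'edges e he)) (hβ₂O t ht)
  -- no crossing of `Q` inside the drawn edges of `A ∪ B`; continuum duality
  have hno := stub_undockedThreeArm_noCrossing hδ Q hAB hβ₁c hβ₁Q hβ₁s0 hβ₁s1 hβ₁A hβ₂c hβ₂Q hβ₂s0 hβ₂s1 hβ₂B
  obtain ⟨β, hβc, hβm, hβ0, hβ1, hβO⟩ := Q.exists_path_avoiding_of_not_exists_isCrossing hδ hno
  have hβm' : ∀ t ∈ Icc (0 : ℝ) 1, a ≤ dist (β t) c ∧ dist (β t) c ≤ b ∧ c.im ≤ (β t).im := fun t ht => by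
    have := hβm ht
    rw [hcar] at this
    exact this
  have hβ0' : dist (β 0) c = a := by rw [hs1] at hβ0; exact hβ0.1
  have hβ1' : dist (β 1) c = b := by rw [hs3] at hβ1; exact hβ1.1
  -- the dual chain of faces of rows `≥ k₀`
  obtain ⟨f, g, hfk, hgk, hf, hg, hchain⟩ := stub_undockedThreeArm_upperFaceChain hδ hβc
    (fun t ht => (hβO t ht).1) k₀ (fun t ht => by rw [← hcim]; exact (hβm' t ht).2.2) (S := S')
    (fun u huk t ht hu => by
      have hd := dist_meshPoint_le_of_mem_face hδ hu
      obtain ⟨h1, h2, -⟩ := hβm' t ht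
      refine ⟨?_, ?_, (hrowS' u).2 huk⟩
      · rw [ha] at h1
        linarith [dist_triangle (β t) (meshPoint δ u) c, dist_comm (meshPoint δ u) (β t)]
      · rw [hb] at h2
        linarith [dist_triangle (meshPoint δ u) (β t) c])
  obtain ⟨Fw, hFwS, hFwAB⟩ := Z2HalfPlane.exists_walk_of_dualConfig_mem_openConnIn hchain
  -- its steps cross edges of `S` outside `A ∪ B`, hence closed edges
  have hFwω : ∀ d ∈ Fw.darts, sepEdge d.fst d.snd ∉ ω := by
    intro d hd
    refine hclosed _ (sepEdge_mem_edgeSet d.adj) (fun w hw => ?_) (hFwAB d hd)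
    have hz : d.fst ∈ S' := hFwS _ (Fw.dart_fst_mem_support_of_mem_darts hd)
    have hwz : dist (meshPoint δ w) (meshPoint δ d.fst) ≤ 4 * δ := dist_meshPoint_le_of_mem_sepEdge hδ d.adj hw
    refine hSbig w ?_ ?_ ?_
    · have h1 := (Z2HalfPlane.sepEdge_apply_one_le hw).2
      have h2 : k₀ ≤ d.fst 1 := (hrowS' _).1 hz.2.2
      exact le_trans h2 (le_trans (le_max_left _ _) h1)
    · linarith [hz.1, dist_triangle (meshPoint δ d.fst) (meshPoint δ w) c, dist_comm (meshPoint δ d.fst) (meshPoint δ w)]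
    · linarith [hz.2.1, dist_triangle (meshPoint δ w) (meshPoint δ d.fst) c]
  -- the disjoint witnesses
  refine ⟨{e | e ∈ W₁'.edges ∨ ∃ d ∈ Fw.darts, e = sepEdge d.fst d.snd}, {e | e ∈ W₂'.edges},
    Set.disjoint_left.2 ?_, fun ω' hω' => ?_, fun ω' hω' => ?_⟩
  · rintro e (he | ⟨d, hd, rfl⟩) he₂
    · have heA := hW₁A e (hW₁'edges e he)
      have heB := hW₂B e (hW₂'edges e he₂)
      induction e using Sym2.ind with
      | h p q => exact hAB _ heA _ heB p (Sym2.mem_mk_left p q) (Sym2.mem_mk_left p q)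
    · exact hFwω d hd (hW₂ω _ (hW₂'edges _ he₂))
  · -- the two-arm event
    refine ⟨x₁, y₁, f, g, ?_, ?_, ?_, ?_, ?_, ?_⟩
    · rw [ha] at hx₁; linarith
    · have hd := dist_meshPoint_le_of_mem_face hδ hf
      rw [ha] at hβ0'
      linarith [dist_triangle (meshPoint δ f) (β 0) c]
    · rw [hb] at hy₁; linarith
    · have hd := dist_meshPoint_le_of_mem_face hδ hg
      rw [hb] at hβ1'
      linarith [dist_triangle (β 1) (meshPoint δ g) c, dist_comm (meshPoint δ g) (β 1)]
    · refine mem_openConnIn_of_walk W₁' (fun z hz => ?_) (fun e he => (hω' e (Or.inl he)).2 (hW₁ω e (hW₁'edges e he)))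
      obtain ⟨hz1, hz2⟩ := hW₁'dist z hz
      rw [habs, ha] at hz1
      rw [habs, hb] at hz2
      exact ⟨by linarith, by linarith, (hrowS' z).2 (hW₁'row z hz)⟩
    · exact Z2HalfPlane.dualConfig_mem_openConnIn_of_walk Fw hFwS fun d hd h =>
        hFwω d hd ((hω' _ (Or.inr ⟨d, hd, rfl⟩)).1 h)
  · -- the open annulus crossing
    rw [mem_annulusOpenCrossing_iff]
    refine ⟨x₂, hx₂, y₂, hy₂, mem_openConnIn_of_walk W₂' (fun z hz => ?_) (fun e he => (hω' e he).2 (hW₂ω e (hW₂'edges e he)))⟩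
    have := (hW₂'dist z hz).2
    rw [habs] at this
    show dist (meshPoint δ z) c ≤ b + 2 * δ
    linarith

end Summit.CriticalPhenomena.CardyFormulaZ2.Cruxes.LagHandOff.HittingTournament
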